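import Summits.ResolutionOfSingularities.ResolutionOfSingularities.Theorems.SectionAscentAffineToGlobalAffineSingularLocus
import Literature.AlgebraicGeometry.Resolution.BlowupsProduct
import Literature.AlgebraicGeometry.Resolution.BlowupsLocal
import Literature.AlgebraicGeometry.Resolution.BlowupsScaling
import Literature.AlgebraicGeometry.Resolution.AffineBlowupIntegral
import HarnessLib

/-!
# Crux `AffineToGlobal` (stmt-ResolutionOfSingularities-15961), line `Sketch`: the yardstick model

Route `ResolutionOfSingularities/SectionAscent`, crux `AffineToGlobal`, line `Sketch` (regular
yardsticks). Support file (`--supports stmt-ResolutionOfSingularities-15961`), registered stub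
`stub_yardstickModel` of the lead's skeleton — the only place where the crux's hypothesis H
(affine one-shot resolutions in characteristic `p`) is consumed, and only through its weak part
"some non-zero ideal `I ⊆ A` with `Bl_I(Spec A)` regular".

**Statement (`stub_yardstickModel`).** Let `Y` be an integral scheme of finite type over a field
`K` of characteristic `p` and assume H. Then there is a blow-up `σ : S → Y` along a non-zero
ideal sheaf `J` such that every point `s ∈ S` has an open neighbourhood `ι : P ↪ S` which is a
blow-up `t : P → R` of a REGULAR integral `K`-scheme of finite type `R`.

**Proof (join of chartwise one-shots).** `Y` is Noetherian; take a finite affine open cover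
`(U_i)` by non-empty affine opens (a finite subcover of Mathlib's `affineCover`, indexed by
points). Each `A_i = Γ(Y, U_i)` is an integral `K`-algebra of finite type of finite Krull
dimension, so H hands a non-zero ideal `I_i ⊆ A_i` with `R_i := Bl_{I_i}(Spec A_i)` regular
(`exists_ideal_isRegular_affineBlowup`). Let `J_i` be the largest extension to `Y` of the ideal
sheaf `Ĩ_i` along the chart `φ_i : Spec A_i → Y` (Mathlib's `IdealSheafData.map`; it restricts
back to `Ĩ_i`, `Limits.comap_map_of_isOpenImmersion`), and `J := ∏_i J_i` (non-zero: `Y` is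
integral, `prod_ne_bot`). Let `σ : S → Y` be a blow-up along `J` (`exists_isBlowup`). For
`s ∈ S` pick `i` with `σ s ∈ U_i` and write `J = J_i · J'`. Over the chart, `S ×_Y Spec A_i →
Spec A_i` is a blow-up along `J|_{Spec A_i} = Ĩ_i · J'|` (flat base change,
`IsBlowup.pullback_snd_of_flat`, `comap_mul`); so is `Bl_{J'𝒪}(R_i) → R_i → Spec A_i` (blowing
up in a product, Stacks 080A = `IsBlowup.comp`, against `affineBlowup.isBlowup`); by uniqueness
of blow-ups `P := S ×_Y Spec A_i ≅ Bl_{J'𝒪}(R_i)` over `Spec A_i`, so `P → R_i` is a blow-up of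
the regular integral variety `R_i` (`exists_isBlowup_pullback_of_eq_mul`), and `P ↪ S` is an
open immersion (base change of `φ_i`) containing `s`.

No new definitions; no statement item is restated. Pattern source: the chart/extension/flat base
change/uniqueness plumbing of `Theorems/SectionAscentAffineToGlobalAffineSingularLocus.lean`.
[cite: StacksProject, Tag 080A] [cite: GortzWedhorn2020, Prop. 13.91]
-/

noncomputable section

set_option linter.dupNamespace false -- mandated namespace of this single-conjunct summit

open CategoryTheory CategoryTheory.Limits AlgebraicGeometry TopologicalSpace
open Literature.AlgebraicGeometry.Resolution

namespace Summit.ResolutionOfSingularities.ResolutionOfSingularities.Theorems.AffineToGlobal.YardstickModel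

universe u

/-! ## Products of non-zero ideal sheaves on an integral scheme -/

/-- On an integral scheme the product of two non-zero (quasi-coherent) ideal sheaves is
non-zero: an ideal sheaf on a reduced scheme vanishes iff its co-support is everything
(Mathlib's `IdealSheafData.support_eq_top_iff`), the co-support of a product is the union of
the co-supports, and an irreducible space is not the union of two proper closed subsets.
[folklore] -/
theorem mul_ne_bot {X : Scheme.{u}} [IsIntegral X] {I J : X.IdealSheafData} (hI : I ≠ ⊥)
    (hJ : J ≠ ⊥) : I * J ≠ ⊥ := by
  intro h
  -- an ideal sheaf whose co-support is everything vanishes (`X` is reduced)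
  have key : ∀ {L : X.IdealSheafData}, (Set.univ : Set X) ⊆ (L.support : Set X) → L = ⊥ :=
    fun {L} hL => Scheme.IdealSheafData.support_eq_top_iff.mp
      (SetLike.coe_injective ((Set.eq_univ_of_univ_subset hL).trans Closeds.coe_top.symm))
  have hs : (Set.univ : Set X) ⊆ (I.support : Set X) ∪ (J.support : Set X) := by
    have h1 : ((I * J).support : Set X) = Set.univ := by
      rw [h, Scheme.IdealSheafData.support_bot]
      rfl
    rw [Scheme.IdealSheafData.support_mul, Closeds.coe_sup] at h1
    exact h1.ge
  rcases isPreirreducible_iff_isClosed_union_isClosed.mp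
      (IrreducibleSpace.isIrreducible_univ X).isPreirreducible _ _ I.support.isClosed
      J.support.isClosed hs with h1 | h1
  · exact hI (key h1)
  · exact hJ (key h1)

/-- On an integral scheme a finite product of non-zero ideal sheaves is non-zero. [folklore] -/
theorem prod_ne_bot {X : Scheme.{u}} [IsIntegral X] {α : Type*} (s : Finset α)
    (J : α → X.IdealSheafData) (hJ : ∀ a ∈ s, J a ≠ ⊥) : ∏ a ∈ s, J a ≠ ⊥ := by
  refine Finset.prod_induction J (fun L => L ≠ ⊥) (fun a b ha hb => mul_ne_bot ha hb) ?_ hJ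
  -- `⊤ ≠ ⊥`: the integral scheme `X` is non-empty
  intro h1
  have h2 : ((⊥ : X.IdealSheafData).support : Set X) = ((⊤ : X.IdealSheafData).support : Set X) := by
    rw [← Scheme.IdealSheafData.one_eq_top, h1]
  rw [Scheme.IdealSheafData.support_bot, Scheme.IdealSheafData.support_top, Closeds.coe_top,
    Closeds.coe_bot] at h2
  obtain ⟨x⟩ := (inferInstance : Nonempty X)
  have hx : x ∈ (Set.univ : Set X) := Set.mem_univ x
  rw [h2] at hx
  exact hx

/-! ## The local structure of a blow-up along a product over a chart -/

/-- **A blow-up along `J₁ · J'` is, over a flat chart on which `J₁` is already blown up by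
`b : R → T`, a blow-up of `R`.** If `σ : S → Y` is a blow-up along `J = J₁ · J'`, `φ : T → Y` is
flat and `b : R → T` is a blow-up along `φ⁻¹J₁ 𝒪_T`, then `S ×_Y T → T` factors as a blow-up
`t : S ×_Y T → R` of `R` along `b⁻¹φ⁻¹J' 𝒪_R` followed by `b`: `S ×_Y T → T` is a blow-up along
`φ⁻¹J 𝒪_T = φ⁻¹J₁ 𝒪_T · φ⁻¹J' 𝒪_T` (flat base change, Görtz–Wedhorn Prop. 13.91 (2)), and so is
`Bl_{b⁻¹φ⁻¹J'}(R) → R → T` (blowing up in a product, Stacks 080A); conclude by uniqueness of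
blow-ups. [cite: StacksProject, Tag 080A] -/
theorem exists_isBlowup_pullback_of_eq_mul {S Y T R : Scheme.{u}} {σ : S ⟶ Y}
    {J J₁ J' : Y.IdealSheafData} (hσ : IsBlowup σ J) (hJ : J = J₁ * J') (φ : T ⟶ Y) [Flat φ]
    {b : R ⟶ T} {𝓘 : T.IdealSheafData} (hb : IsBlowup b 𝓘) (hφ : J₁.comap φ = 𝓘) :
    ∃ t : pullback σ φ ⟶ R, IsBlowup t ((J'.comap φ).comap b) ∧ t ≫ b = pullback.snd σ φ := by
  -- over the chart: `S ×_Y T → T` is a blow-up along `𝓘 · φ⁻¹J'`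
  have hP : IsBlowup (pullback.snd σ φ) (𝓘 * J'.comap φ) := by
    have h1 := hσ.pullback_snd_of_flat φ
    rwa [hJ, comap_mul, hφ] at h1
  -- so is `Bl_{b⁻¹φ⁻¹J'}(R) → R → T`
  obtain ⟨B, t', ht'⟩ := exists_isBlowup R ((J'.comap φ).comap b)
  have hcomp : IsBlowup (t' ≫ b) (𝓘 * J'.comap φ) := hb.comp ht'
  -- uniqueness of blow-ups
  obtain ⟨e, he, -⟩ := hP.unique hcomp
  exact ⟨e.hom ≫ t', ht'.iso_comp e, by rw [Category.assoc]; exact he⟩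

/-! ## Chartwise one-shots from the hypothesis H -/

/-- **The weak part of H on an affine chart.** Assume affine one-shot resolutions in
characteristic `p` in all dimensions (the crux's hypothesis, written out). If `Y` is an integral
scheme locally of finite type over a field `K` of characteristic `p` and `U ⊆ Y` is a non-empty
affine open, then `Γ(Y, U)` — an integral `K`-algebra of finite type, of finite Krull dimension
(`exists_ringKrullDim_eq_and_trdeg_eq`) — carries a non-zero ideal `I` with `Bl_I(Spec Γ(Y, U))`
regular. [cite: Temkin2008, §2.1] -/
theorem exists_ideal_isRegular_affineBlowup (p : ℕ)
    (h : ∀ d : ℕ, ∀ (K : Type) [Field K] [CharP K p] (A : Type) [CommRing A] [IsDomain A]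
      [Algebra K A] [Algebra.FiniteType K A], ringKrullDim A < (d : WithBot ℕ∞) →
      ∃ I : Ideal A, I ≠ ⊥ ∧
        Literature.AlgebraicGeometry.Resolution.Scheme.IsRegular
          (Literature.AlgebraicGeometry.Resolution.affineBlowup I) ∧
        ∀ 𝔭 : PrimeSpectrum A, I ≤ 𝔭.asIdeal ↔
          ¬ IsRegularLocalRing (Localization.AtPrime 𝔭.asIdeal))
    (K : Type) [Field K] [CharP K p] (Y : Scheme.{0}) [IsIntegral Y] (f : Y ⟶ Spec (.of K))
    [LocallyOfFiniteType f] (U : Y.Opens) (hU : IsAffineOpen U) [Nonempty U] :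
    ∃ I : Ideal Γ(Y, U), I ≠ ⊥ ∧ Scheme.IsRegular (affineBlowup I) := by
  haveI : IsDomain Γ(Y, U) := IsIntegral.component_integral U
  letI : Algebra K Γ(Y, U) :=
    ((f.appLE ⊤ U le_top).hom.comp (Scheme.ΓSpecIso (.of K)).inv.hom).toAlgebra
  haveI : Algebra.FiniteType K Γ(Y, U) := by
    have hft : RingHom.FiniteType (f.appLE ⊤ U le_top).hom :=
      HasRingHomProperty.appLE @LocallyOfFiniteType f inferInstance ⟨⊤, isAffineOpen_top _⟩
        ⟨U, hU⟩ le_top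
    exact hft.comp (RingHom.FiniteType.of_surjective _
      (Scheme.ΓSpecIso (.of K)).commRingCatIsoToRingEquiv.symm.surjective)
  obtain ⟨n, hn, -⟩ := exists_ringKrullDim_eq_and_trdeg_eq K Γ(Y, U)
  obtain ⟨I, hI, hIreg, -⟩ := h (n + 1) K Γ(Y, U) (by
    rw [hn]
    exact_mod_cast Nat.lt_succ_self n)
  exact ⟨I, hI, hIreg⟩

/-! ## The yardstick model -/

/-- **STUB `stub_yardstickModel` of crux `AffineToGlobal` (stmt-ResolutionOfSingularities-15961),
line `Sketch`, registered signature: the yardstick model.** Assume affine one-shot resolutions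
in characteristic `p` in all dimensions (the crux's hypothesis H, written out; only its weak
part is used). For `Y` integral of finite type over a field `K` of characteristic `p` there is a
blow-up `σ : S → Y` along a non-zero ideal sheaf `J` such that every point `s ∈ S` has an open
neighbourhood `ι : P ↪ S` which is a blow-up `t : P → R` of a regular integral `K`-scheme of
finite type `R`. Construction (module docstring): `J = ∏ J_i` for the largest extensions `J_i`
of the centres `Ĩ_i` of chartwise one-shots `R_i = Bl_{I_i}(Spec Γ(Y, U_i)) → U_i` over a finite
cover by non-empty affine opens `U_i`; over the chart `U_i ∋ σ s`, `P = S ×_Y Spec Γ(Y, U_i)` is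
a blow-up of `R_i` (flat base change, blowing up in a product = Stacks 080A, uniqueness of
blow-ups), `R_i` is integral (`I_i ≠ 0`) and of finite type over `K` (proper over the chart).
[cite: StacksProject, Tag 080A] -/
theorem stub_yardstickModel (p : ℕ)
    (h : ∀ d : ℕ, ∀ (K : Type) [Field K] [CharP K p] (A : Type) [CommRing A] [IsDomain A]
      [Algebra K A] [Algebra.FiniteType K A], ringKrullDim A < (d : WithBot ℕ∞) →
      ∃ I : Ideal A, I ≠ ⊥ ∧
        Literature.AlgebraicGeometry.Resolution.Scheme.IsRegular
          (Literature.AlgebraicGeometry.Resolution.affineBlowup I) ∧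
        ∀ 𝔭 : PrimeSpectrum A, I ≤ 𝔭.asIdeal ↔
          ¬ IsRegularLocalRing (Localization.AtPrime 𝔭.asIdeal))
    (K : Type) [Field K] [CharP K p] (Y : Scheme.{0}) [IsIntegral Y] (f : Y ⟶ Spec (.of K))
    [LocallyOfFiniteType f] [QuasiCompact f] :
    ∃ (S : Scheme.{0}) (σ : S ⟶ Y) (J : Y.IdealSheafData), J ≠ ⊥ ∧ IsBlowup σ J ∧
      ∀ s : S, ∃ (R : Scheme.{0}) (fR : R ⟶ Spec (.of K)) (_ : IsIntegral R)
        (_ : LocallyOfFiniteType fR) (_ : QuasiCompact fR) (P : Scheme.{0}) (ι : P ⟶ S)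
        (_ : IsOpenImmersion ι) (t : P ⟶ R) (Q : R.IdealSheafData),
        Scheme.IsRegular R ∧ IsBlowup t Q ∧ s ∈ Set.range ι := by
  classical
  haveI : IsLocallyNoetherian Y := LocallyOfFiniteType.isLocallyNoetherian f
  haveI : CompactSpace Y := QuasiCompact.compactSpace_of_compactSpace f
  haveI : IsNoetherian Y := {}
  -- a finite cover of `Y` by non-empty affine opens `U i`
  let 𝒰 := Y.affineCover.finiteSubcover
  let U : 𝒰.I₀ → Y.Opens := fun i => (𝒰.f i).opensRange
  have hU : ∀ i, IsAffineOpen (U i) := fun i => isAffineOpen_opensRange (𝒰.f i)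
  have hmem : ∀ i : 𝒰.I₀, i.1 ∈ U i := fun i => Y.affineCover.covers i.1
  haveI : ∀ i, Nonempty (U i) := fun i => ⟨⟨i.1, hmem i⟩⟩
  have hcover : ∀ y : Y, ∃ i, y ∈ U i := fun y => by
    have hy : y ∈ (⊤ : Y.Opens) := trivial
    rw [← 𝒰.iSup_opensRange, Opens.mem_iSup] at hy
    exact hy
  -- chartwise one-shots `Bl_{I i}(Spec Γ(Y, U i))` (hypothesis H, weak part)
  choose I hI hreg using fun i => exists_ideal_isRegular_affineBlowup p h K Y f (U i) (hU i)
  -- the charts `φ i`, the centres `𝓘 i = Ĩ_i` and their largest extensions `Jc i` to `Y`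
  let φ : ∀ i, Spec Γ(Y, U i) ⟶ Y := fun i => (hU i).fromSpec
  let 𝓘 : ∀ i, (Spec Γ(Y, U i)).IdealSheafData := fun i => affineBlowup.idealSheaf (I i)
  let Jc : 𝒰.I₀ → Y.IdealSheafData := fun i => (𝓘 i).map (φ i)
  have hJφ : ∀ i, (Jc i).comap (φ i) = 𝓘 i := fun i =>
    Literature.AlgebraicGeometry.Limits.comap_map_of_isOpenImmersion (φ i) (𝓘 i)
  have hJc : ∀ i, Jc i ≠ ⊥ := fun i hi => by
    have h1 := hJφ i
    rw [hi, Scheme.IdealSheafData.comap_bot] at h1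
    exact affineBlowup.idealSheaf_ne_bot (hI i) h1.symm
  -- the centre `J = ∏ Jc i ≠ 0` and the model `σ : S → Y`
  let J : Y.IdealSheafData := ∏ i, Jc i
  have hJ : J ≠ ⊥ := prod_ne_bot Finset.univ Jc fun i _ => hJc i
  obtain ⟨S, σ, hσ⟩ := exists_isBlowup Y J
  refine ⟨S, σ, J, hJ, hσ, fun s => ?_⟩
  -- local structure at `s`: a chart `U i ∋ σ s`, `J = Jc i * J'`
  obtain ⟨i, hi⟩ := hcover (σ s)
  have hJi : J = Jc i * ∏ j ∈ Finset.univ.erase i, Jc j :=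
    (Finset.mul_prod_erase Finset.univ Jc (Finset.mem_univ i)).symm
  -- `S ×_Y Spec Γ(Y, U i)` is a blow-up of `R = Bl_{I i}(Spec Γ(Y, U i))`
  obtain ⟨t, ht, -⟩ := exists_isBlowup_pullback_of_eq_mul hσ hJi (φ i)
    (affineBlowup.isBlowup (I i)) (hJφ i)
  -- `R` is a regular integral `K`-scheme of finite type
  haveI : IsNoetherianRing Γ(Y, U i) := IsLocallyNoetherian.component_noetherian ⟨U i, hU i⟩
  haveI : IsIntegral (affineBlowup (I i)) := affineBlowup.isIntegral (hI i)
  let fR : affineBlowup (I i) ⟶ Spec (.of K) := affineBlowup.π (I i) ≫ φ i ≫ f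
  haveI : LocallyOfFiniteType fR := inferInstance
  haveI : QuasiCompact fR := inferInstance
  -- `s` lies in the open piece `S ×_Y Spec Γ(Y, U i) ↪ S`
  have hs : s ∈ Set.range (pullback.fst σ (φ i)) := by
    rw [Scheme.Pullback.range_fst]
    change σ s ∈ Set.range (hU i).fromSpec
    rw [(hU i).range_fromSpec]
    exact hi
  exact ⟨affineBlowup (I i), fR, inferInstance, inferInstance, inferInstance, pullback σ (φ i),
    pullback.fst σ (φ i), inferInstance, t, _, hreg i, ht, hs⟩

end Summit.ResolutionOfSingularities.ResolutionOfSingularities.Theorems.AffineToGlobal.YardstickModel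

end
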